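import Summits.QuantumFields.YangMills.Theorems.BalabanLadderNTMarkovMirror
import HarnessLib

/-!
# Crux `NT` (stmt-QuantumFields-19353) / `UVSeamRec.stub_floorsEngine` (stmt-QuantumFields-20043):
# the shell floor (SF) of card E may be paid in ONE reference state plus sign-free oscillation ceilings

Eleventh file of the Markov–mirror series (fleet lead prover of crux `UVSeamRec`, unit `ym-spine-20043-p1`, g6).
Card `markov-mirror-dirichlet-response` (§Mechanism 3, «may be asked instead in ONE reference state + osc ceilings,
§D D3′») and card `reference-state-transfer` meet here: the shell floor (SF) `Cov_T(𝒢∘Θ₀, 𝒢) ≥ 4ε` on EVERY odd torus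
follows from a floor `kerCov_Q^{η₀}(𝒢∘Θ₀, 𝒢) ≥ 4ε + 2h² + ω` in ONE kernel reference state of a cube `Q` containing
a window cube `P ⊇ supp 𝒢 ∪ supp (𝒢∘Θ₀)` (straddling the reflection plane), together with the sign-free oscillation
ceilings `h` (of the `P`-kernel means of `𝒢` and of `𝒢∘Θ₀` over exteriors) and `ω` (of their `P`-kernel covariance)
— by the 19353 lead's two-sided reference transfer `Reference.abs_torusCov_sub_kerCov_le` (p498266).  So the engine may
certify SF in the state of its choosing (cold wall, twisted, …), exactly as in the reference currency.

* `shellFloor_of_reference` — the statement above, per coupling, for every torus `2L+1 ≥ b₀ + 3`.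
-/

set_option autoImplicit false

noncomputable section

open MeasureTheory Filter Topology
open Literature.MathematicalPhysics.QuantumFieldTheory Literature.MathematicalPhysics.QuantumLattice
open Literature.Probability.LatticeModels
open Summit.QuantumFields.YangMills.Cruxes.OSLegsFromFemtoAndGap.DlrCollarTransfer
open Summit.QuantumFields.YangMills.Cruxes.NT.Reference (abs_torusCov_sub_kerCov_le)

namespace Summit.QuantumFields.YangMills.Cruxes.NT.MarkovMirror

section Shell

variable (G : Type) [Group G] [TopologicalSpace G] [IsTopologicalGroup G] [CompactSpace G]
  [MeasurableSpace G] [BorelSpace G] (r : LatticeRep G)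

/-- **The shell floor from one reference state.**  Nested cubes `P = (c₀, b₀) ⊆ Q = (c, b)` (interior links), a
reference exterior `η₀` of `Q`, a bounded continuous cylinder shell functional `𝒢` whose links AND whose reflected
links (`reflectEdge '' supp`) are based in the window `[c₀, c₀ + b₀]` of `P`; sign-free oscillation ceilings over
exteriors of `P`: `|kerE_P^ζ(𝒢) − kerE_P^{ζ'}(𝒢)| ≤ h`, `|kerE_P^ζ(𝒢∘Θ₀) − kerE_P^{ζ'}(𝒢∘Θ₀)| ≤ h`,
`|kerCov_P^ζ(𝒢∘Θ₀, 𝒢) − kerCov_P^{ζ'}(𝒢∘Θ₀, 𝒢)| ≤ ω`; and the reference floor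
`4ε + 2h² + ω ≤ kerCov_Q^{η₀}(𝒢∘Θ₀, 𝒢)`.  Then on every torus `2L+1 ≥ b₀ + 3` the shell floor (SF) of card E holds:
`4ε ≤ Cov_T(𝒢∘Θ₀, 𝒢)`. [folklore] -/
theorem shellFloor_of_reference (β : ℝ) {c c₀ : Fin 4 → ℤ} {b b₀ : ℕ} (hsub : cubeEdges c₀ b₀ ⊆ cubeEdges c b)
    (η₀ : LGConfig 4 G) {𝒢 : LGConfig 4 G → ℝ} (h𝒢c : Continuous 𝒢) {M𝒢 : ℝ} (hM𝒢 : ∀ U, |𝒢 U| ≤ M𝒢)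
    {S𝒢 : Finset (Literature.MathematicalPhysics.QuantumLattice.ZdEdge 4)} (h𝒢S : IsCylinder 𝒢 S𝒢)
    (hS : ∀ e ∈ S𝒢, ∀ j, c₀ j ≤ e.1 j ∧ e.1 j ≤ c₀ j + b₀)
    (hSr : ∀ e ∈ S𝒢.image reflectEdge, ∀ j, c₀ j ≤ e.1 j ∧ e.1 j ≤ c₀ j + b₀)
    {h ω ε : ℝ}
    (hoG : ∀ ζ ζ', |kerE G r β c₀ b₀ ζ 𝒢 - kerE G r β c₀ b₀ ζ' 𝒢| ≤ h)
    (hoGr : ∀ ζ ζ', |kerE G r β c₀ b₀ ζ (fun V => 𝒢 (cfgReflect V)) -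
      kerE G r β c₀ b₀ ζ' (fun V => 𝒢 (cfgReflect V))| ≤ h)
    (hoC : ∀ ζ ζ', |kerCov G r β c₀ b₀ ζ (fun V => 𝒢 (cfgReflect V)) 𝒢 -
      kerCov G r β c₀ b₀ ζ' (fun V => 𝒢 (cfgReflect V)) 𝒢| ≤ ω)
    (hfloor : 4 * ε + 2 * h * h + ω ≤ kerCov G r β c b η₀ (fun V => 𝒢 (cfgReflect V)) 𝒢)
    (L : ℕ) (hL : b₀ + 3 ≤ 2 * L + 1) :
    4 * ε ≤ torusE G r β L (fun V => 𝒢 (cfgReflect V) * 𝒢 V) -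
      torusE G r β L (fun V => 𝒢 (cfgReflect V)) * torusE G r β L 𝒢 := by
  classical
  have hFc : Continuous fun V : LGConfig 4 G => 𝒢 (cfgReflect V) := h𝒢c.comp continuous_cfgReflect
  have hMF : ∀ V : LGConfig 4 G, |𝒢 (cfgReflect V)| ≤ M𝒢 := fun V => hM𝒢 _
  have key := abs_torusCov_sub_kerCov_le G r β hsub η₀ L hL hFc h𝒢c hMF hM𝒢 (isCylinder_comp_cfgReflect h𝒢S)
    h𝒢S hSr hS hoGr hoG hoC
  have := (abs_le.1 key).1
  linarith

end Shell

end Summit.QuantumFields.YangMills.Cruxes.NT.MarkovMirror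

end
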